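import Summits.Ventures.Crystal3D.Theorems.StickyWulffConstantTextureBuildLayerLateral
import Summits.Ventures.Crystal3D.Theorems.StickyWulffConstantTextureBuildLayerPropagation
import Summits.Ventures.Crystal3D.Theorems.StickyWulffConstantTextureLiminfCubeRigidityLayerSteps
import HarnessLib

/-!
# TB-1 brick L-PROP-5: the DESCENT FROM A SINGLE SHELL with PER-LEVEL locality — base re-expanded too, hypotheses level by level, inclined-twin escape at every level
# (lane T, crux `TextureLiminfV5`, stmt-Ventures-23912; memo HOME/wulff-p2/g25/SLAB-PLATES-g25.md §6/§7)

HONEST FRAMING. Venture `Summits/Ventures/Crystal3D` (cell `crystal3d-full`), route `route-Ventures-StickyWulffConstant`, helper `--supports` the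
law-v5 crux `TextureLiminfV5` (stmt-Ventures-23912).  Census-free, standard axioms: the recursion of '…TextureBuildLayerDescent' (`exists_local_stacking_descent`)
sharpened in two ways.  No cover is built; F-C1 not moved.

WHY.  (1) The base datum of `exists_local_stacking_descent` is a disc of radius `N 0`, i.e. a chart of that radius — but charts cost `168×` clearance; here the
base is ONLY the centre `0 ∈ V` with its layer shell `layerShell σ σ'` (any close-packed ball, in the frame of its shell), and level `0` is re-expanded like every
other level (so the inclined-twin witness may now sit at level `0`: `σ' = −σ` and an HCP-arranged centre there).  (2) The arrangement hypothesis is PER LEVEL: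
at level `m` only centres with `|u₃ + m·h| ≤ 2` and `‖u‖ ≤ 2m + 2·N m + 4` are asked — so the caller may shape the certified region as a STAIRCASE hugging an
inclined wall (radii `N m` shrinking toward it), never asking about material beyond the wall.

* **`exists_local_stacking_descent_shell`** — `0 ∈ V` with `kissingShell V 0 = layerShell σ σ'`; radii `N m ≥ 2` (`m ≤ K + 1`); FCC/HCP arrangements at the
  centres `u` with `|u₃ + m·h| ≤ 2`, `‖u‖ ≤ 2m + 2·N m + 4` for some `m ≤ K + 1`.  Conclusion: a Hägg word `s` such that for every `M ≤ K + 1`, unless an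
  inclined-twin witness occurs at a level `≤ M` (level `0`: `σ' = −σ` with an HCP-arranged centre of index `≤ N 0 + 1`; level `m ≥ 1`: `s(−m−1) = s(−m)` with
  one of index `≤ N m + 1`), every site `barlowPos 2 h s (−M) i j`, `|i| + |j| ≤ N M`, is a centre of `V`.
-/

noncomputable section

namespace Summit.Ventures.Crystal3D.Theorems.LocalStacking

open Literature.Geometry.DiscreteGeometry Literature.MathematicalPhysics.StatisticalMechanics
open RealInnerProductSpace Summit.Ventures.Crystal3D.L2B

variable {V : Set (EuclideanSpace ℝ (Fin 3))}

/-- **THE DESCENT FROM A SINGLE SHELL, PER-LEVEL LOCAL.**  See the module docstring. -/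
theorem exists_local_stacking_descent_shell (hV : IsUnitBallPacking V) {σ σ' : ℝ} (hσ : σ = 1 ∨ σ = -1) (hσ' : σ' = 1 ∨ σ' = -1)
    (h0 : (0 : EuclideanSpace ℝ (Fin 3)) ∈ V) (hS0 : kissingShell V 0 = layerShell σ σ')
    (N : ℕ → ℤ) (K : ℕ) (hN2 : ∀ m, m ≤ K + 1 → 2 ≤ N m)
    (hcp : ∀ u ∈ V, ∀ m : ℕ, m ≤ K + 1 → |u 2 + m * layerSpacing| ≤ 2 → ‖u‖ ≤ 2 * m + 2 * (N m) + 4 →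
      IsArrangedIn (kissingShell V u) fccKissingPattern ∨ IsArrangedIn (kissingShell V u) hcpKissingPattern) :
    ∃ s : ℤ → ℤ, IsHaggSeq s ∧ ∀ M : ℕ, M ≤ K + 1 →
      ¬ (σ' = -σ ∧ ∃ i j : ℤ, |i| + |j| ≤ N 0 + 1 ∧ barlowPos 2 layerSpacing s 0 i j ∈ V ∧
          IsArrangedIn (kissingShell V (barlowPos 2 layerSpacing s 0 i j)) hcpKissingPattern) →
      (¬ ∃ m : ℕ, 1 ≤ m ∧ m ≤ M ∧ s (-(m : ℤ) - 1) = s (-(m : ℤ)) ∧ ∃ i j : ℤ, |i| + |j| ≤ N m + 1 ∧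
          barlowPos 2 layerSpacing s (-(m : ℤ)) i j ∈ V ∧
          IsArrangedIn (kissingShell V (barlowPos 2 layerSpacing s (-(m : ℤ)) i j)) hcpKissingPattern) →
      ∀ i j : ℤ, |i| + |j| ≤ N M → barlowPos 2 layerSpacing s (-(M : ℤ)) i j ∈ V := by
  classical
  let dnT : (EuclideanSpace ℝ (Fin 3)) → ℤ := fun c => if c + (barlowOffset (2 : ℝ) - layerNormal layerSpacing) ∈ V then 1 else -1
  have dnT_sign : ∀ c, ((dnT c : ℤ) : ℝ) = 1 ∨ ((dnT c : ℤ) : ℝ) = -1 := fun c => by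
    simp only [dnT]; split_ifs <;> simp
  have dnT_int : ∀ c, dnT c = 1 ∨ dnT c = -1 := fun c => by simp only [dnT]; split_ifs <;> simp
  have dnT_eq : ∀ {c : (EuclideanSpace ℝ (Fin 3))} {ρ ρ' : ℝ}, (ρ' = 1 ∨ ρ' = -1) → kissingShell V c = layerShell ρ ρ' →
      ((dnT c : ℤ) : ℝ) = ρ' := by
    intro c ρ ρ' hρ' h; rw [lower_type_eq hρ' h]; simp only [dnT]; split_ifs <;> simp
  let bdn : ℕ → (EuclideanSpace ℝ (Fin 3)) := fun m => Nat.rec (motive := fun _ => (EuclideanSpace ℝ (Fin 3))) 0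
    (fun _ b => b + (((dnT b : ℤ) : ℝ) • barlowOffset (2 : ℝ) - layerNormal layerSpacing)) m
  have bdn_zero : bdn 0 = 0 := rfl
  have bdn_succ : ∀ m, bdn (m + 1) = bdn m + (((dnT (bdn m) : ℤ) : ℝ) • barlowOffset (2 : ℝ) - layerNormal layerSpacing) := fun m => rfl
  have norm_bdn : ∀ m : ℕ, ‖bdn m‖ ≤ 2 * m := by
    intro m
    induction m with
    | zero => simp [bdn_zero]
    | succ m ih =>
      rw [bdn_succ]
      calc ‖bdn m + (((dnT (bdn m) : ℤ) : ℝ) • barlowOffset (2 : ℝ) - layerNormal layerSpacing)‖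
            ≤ ‖bdn m‖ + ‖((dnT (bdn m) : ℤ) : ℝ) • (barlowOffset (2 : ℝ)) - layerNormal layerSpacing‖ := norm_add_le _ _
        _ ≤ 2 * m + 2 := by rw [norm_sign_smul_frameW_sub_frameE (dnT_sign _)]; linarith
        _ = 2 * (m + 1 : ℕ) := by push_cast; ring
  have two_bdn : ∀ m : ℕ, (bdn m) 2 = -(m * layerSpacing) := by
    intro m
    induction m with
    | zero => simp [bdn_zero]
    | succ m ih => rw [bdn_succ, apply_two_frameStep_down, ih]; push_cast; ring
  -- (a) the descent hypothesis of `layerDisc_down` at level `m ≤ K`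
  have cpDown : ∀ m : ℕ, m ≤ K → ∀ i j : ℤ, |i| + |j| ≤ N m → ∀ y ∈ kissingShell V (bdn m + latPt i j),
      IsArrangedIn (kissingShell V (bdn m + latPt i j + y)) fccKissingPattern ∨
        IsArrangedIn (kissingShell V (bdn m + latPt i j + y)) hcpKissingPattern := by
    intro m hm i j hij y hy
    refine hcp _ hy.1 m (by omega) ?_ ?_
    · have hy2 : |y 2| ≤ 2 := by
        rw [← hy.2]
        have := PiLp.norm_apply_le y 2
        rwa [Real.norm_eq_abs] at this
      have e : (bdn m + latPt i j + y) 2 + m * layerSpacing = y 2 := by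
        rw [PiLp.add_apply, PiLp.add_apply, latPt_apply_two, two_bdn]; ring
      rw [e]; exact hy2
    · have hij' : ((|i| + |j| : ℤ) : ℝ) ≤ N m := by exact_mod_cast hij
      calc ‖bdn m + latPt i j + y‖ ≤ ‖bdn m‖ + ‖latPt i j‖ + ‖y‖ := norm_add₃_le
        _ ≤ 2 * m + 2 * (|i| + |j| : ℤ) + 2 := by rw [hy.2]; linarith [norm_latPt_le i j, norm_bdn m]
        _ ≤ 2 * m + 2 * (N m) + 4 := by linarith
  -- (b) the re-expansion hypothesis at level `m ≤ K + 1`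
  have cpLevel : ∀ m : ℕ, m ≤ K + 1 → ∀ i j : ℤ, |i| + |j| ≤ N m + 1 → bdn m + latPt i j ∈ V →
      IsArrangedIn (kissingShell V (bdn m + latPt i j)) fccKissingPattern ∨
        IsArrangedIn (kissingShell V (bdn m + latPt i j)) hcpKissingPattern := by
    intro m hm i j hij hmem
    refine hcp _ hmem m hm ?_ ?_
    · have e : (bdn m + latPt i j) 2 + m * layerSpacing = 0 := by
        rw [PiLp.add_apply, latPt_apply_two, two_bdn]; ring
      rw [e, abs_zero]; norm_num
    · have hij' : ((|i| + |j| : ℤ) : ℝ) ≤ N m + 1 := by exact_mod_cast hij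
      calc ‖bdn m + latPt i j‖ ≤ ‖bdn m‖ + ‖latPt i j‖ := norm_add_le _ _
        _ ≤ 2 * m + 2 * (|i| + |j| : ℤ) := by linarith [norm_latPt_le i j, norm_bdn m]
        _ ≤ 2 * m + 2 * (N m) + 4 := by linarith
  -- the level-0 type
  have e0 : ((dnT 0 : ℤ) : ℝ) = σ' := dnT_eq hσ' hS0
  -- the invariant with witnesses at levels `0 … m`
  have inv : ∀ m : ℕ, m ≤ K + 1 →
      (∃ τ : ℝ, (τ = 1 ∨ τ = -1) ∧ LayerDisc V (bdn m) τ ((dnT (bdn m) : ℤ) : ℝ) (N m)) ∨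
      (σ' = -σ ∧ ∃ i j : ℤ, |i| + |j| ≤ N 0 + 1 ∧ bdn 0 + latPt i j ∈ V ∧
          IsArrangedIn (kissingShell V (bdn 0 + latPt i j)) hcpKissingPattern) ∨
      (∃ m₀ : ℕ, m₀ + 1 ≤ m ∧ ((dnT (bdn (m₀ + 1)) : ℤ) : ℝ) ≠ -((dnT (bdn m₀) : ℤ) : ℝ) ∧
        ∃ i j : ℤ, |i| + |j| ≤ N (m₀ + 1) + 1 ∧ bdn (m₀ + 1) + latPt i j ∈ V ∧
          IsArrangedIn (kissingShell V (bdn (m₀ + 1) + latPt i j)) hcpKissingPattern) := by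
    intro m
    induction m with
    | zero =>
      intro _
      have hK0 : 0 ≤ K + 1 := by omega
      have hS0' : kissingShell V (bdn 0) = layerShell σ σ' := by rw [bdn_zero]; exact hS0
      have h0' : bdn 0 ∈ V := by rw [bdn_zero]; exact h0
      by_cases hss : σ' = σ
      · -- HCP-type base layer
        left
        refine ⟨σ, hσ, ?_⟩
        have hS'' : kissingShell V (bdn 0) = layerShell σ σ := by rw [hS0', hss]
        have h := layerDisc_hcp_local hV h0' hσ hS'' (N 0) (cpLevel 0 hK0)
        rw [show ((dnT (bdn 0) : ℤ) : ℝ) = σ by rw [bdn_zero, e0, hss]]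
        exact h
      · have hneg : σ' = -σ := by
          rcases hσ with h | h <;> rcases hσ' with h' | h'
          · exact absurd (h'.trans h.symm) hss
          · rw [h, h']
          · rw [h, h']; norm_num
          · exact absurd (h'.trans h.symm) hss
        by_cases hw : ∃ i j : ℤ, |i| + |j| ≤ N 0 + 1 ∧ bdn 0 + latPt i j ∈ V ∧
            IsArrangedIn (kissingShell V (bdn 0 + latPt i j)) hcpKissingPattern
        · exact Or.inr (Or.inl ⟨hneg, hw⟩)
        · left
          push Not at hw
          refine ⟨σ, hσ, ?_⟩
          have h := layerDisc_fcc_local hV h0' hσ hσ' hS0' (N 0) fun i j hij hmem => by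
            rcases cpLevel 0 hK0 i j hij hmem with h | h
            · exact h
            · exact absurd h (hw i j hij hmem)
          rw [show ((dnT (bdn 0) : ℤ) : ℝ) = σ' by rw [bdn_zero, e0]]
          exact h
    | succ m ih =>
      intro hm
      have hmK : m ≤ K := by omega
      rcases ih (by omega) with ⟨τ, hτ, hD⟩ | hbad0 | ⟨m₀, hm₀, hbad⟩
      · obtain ⟨ρ', hρ', hD'⟩ := layerDisc_down hV (dnT_sign (bdn m)) hD (cpDown m hmK)
        rw [← bdn_succ] at hD'
        have hmτ : (-((dnT (bdn m) : ℤ) : ℝ) = 1 ∨ -((dnT (bdn m) : ℤ) : ℝ) = -1) := by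
          rcases dnT_sign (bdn m) with h | h <;> rw [h] <;> norm_num
        have h00 := hD' 0 0 (by simp; linarith [hN2 m (by omega)])
        rw [latPt_zero, add_zero] at h00
        obtain ⟨hcV, hSc⟩ := h00
        have eρ : ((dnT (bdn (m + 1)) : ℤ) : ℝ) = ρ' := dnT_eq hρ' hSc
        by_cases htype : ρ' = -((dnT (bdn m) : ℤ) : ℝ)
        · left
          refine ⟨-((dnT (bdn m) : ℤ) : ℝ), hmτ, ?_⟩
          have hS' : kissingShell V (bdn (m + 1)) = layerShell ρ' ρ' := by rw [hSc, ← htype]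
          have h := layerDisc_hcp_local hV hcV hρ' hS' (N (m + 1)) (cpLevel (m + 1) hm)
          rw [eρ, ← htype]; exact h
        · by_cases hw : ∃ i j : ℤ, |i| + |j| ≤ N (m + 1) + 1 ∧ bdn (m + 1) + latPt i j ∈ V ∧
              IsArrangedIn (kissingShell V (bdn (m + 1) + latPt i j)) hcpKissingPattern
          · right; right
            refine ⟨m, le_rfl, ?_, hw⟩
            rw [eρ]; exact htype
          · left
            push Not at hw
            refine ⟨-((dnT (bdn m) : ℤ) : ℝ), hmτ, ?_⟩
            have h := layerDisc_fcc_local hV hcV hmτ hρ' hSc (N (m + 1)) fun i j hij hmem => by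
              rcases cpLevel (m + 1) hm i j hij hmem with h | h
              · exact h
              · exact absurd h (hw i j hij hmem)
            rw [eρ]; exact h
      · exact Or.inr (Or.inl hbad0)
      · exact Or.inr (Or.inr ⟨m₀, by omega, hbad⟩)
  -- the Hägg word (downward letters read off the packing; upward letters immaterial)
  let sq : ℤ → ℤ := fun k => if 0 ≤ k then 1 else -dnT (bdn (-k - 1).toNat)
  have hsq : IsHaggSeq sq := by
    intro k
    by_cases hk : 0 ≤ k
    · refine Or.inl ?_
      simp only [sq, if_pos hk]
    · simp only [sq, if_neg hk]; rcases dnT_int (bdn (-k - 1).toNat) with h | h <;> rw [h] <;> norm_num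
  have sq_neg : ∀ m : ℕ, sq (-((m : ℤ) + 1)) = -dnT (bdn m) := fun m => by
    have h1 : ¬ (0 : ℤ) ≤ -((m : ℤ) + 1) := by omega
    have h2 : (-(-((m : ℤ) + 1)) - 1).toNat = m := by simp
    simp only [sq, if_neg h1, h2]
  have dn_pos : ∀ m : ℕ, bdn m = (haggLabel sq (-(m : ℤ)) : ℝ) • (barlowOffset (2 : ℝ)) + ((-(m : ℤ) : ℤ) : ℝ) • layerNormal layerSpacing := by
    intro m
    induction m with
    | zero => simp [bdn_zero]
    | succ m ih =>
      have hrec : haggLabel sq (-(m : ℤ)) = haggLabel sq (-((m : ℤ) + 1)) + sq (-((m : ℤ) + 1)) := by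
        have := haggLabel_succ sq (-((m : ℤ) + 1))
        rwa [show -((m : ℤ) + 1) + 1 = -(m : ℤ) by ring] at this
      rw [bdn_succ]
      set ν := dnT (bdn m) with hν
      rw [ih]
      have e : (haggLabel sq (-((m + 1 : ℕ) : ℤ)) : ℝ) = haggLabel sq (-(m : ℤ)) + ν := by
        rw [Nat.cast_succ, hrec, sq_neg m, ← hν]; push_cast; ring
      rw [e]
      push_cast
      module
  have site : ∀ (m : ℕ) (i j : ℤ), barlowPos 2 layerSpacing sq (-(m : ℤ)) i j = bdn m + latPt i j := by
    intro m i j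
    rw [barlowPos_eq_latPt, add_comm, dn_pos m]
  have site0 : ∀ i j : ℤ, barlowPos 2 layerSpacing sq 0 i j = bdn 0 + latPt i j := by
    intro i j
    have := site 0 i j
    rwa [show (-((0 : ℕ) : ℤ)) = 0 by simp] at this
  have typ : ∀ m₀ : ℕ, ((dnT (bdn (m₀ + 1)) : ℤ) : ℝ) ≠ -((dnT (bdn m₀) : ℤ) : ℝ) →
      sq (-((m₀ + 1 : ℕ) : ℤ) - 1) = sq (-((m₀ + 1 : ℕ) : ℤ)) := by
    intro m₀ hne
    have e1 : sq (-((m₀ + 1 : ℕ) : ℤ) - 1) = -dnT (bdn (m₀ + 1)) := by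
      rw [show -((m₀ + 1 : ℕ) : ℤ) - 1 = -(((m₀ + 1 : ℕ) : ℤ) + 1) by ring]; exact sq_neg (m₀ + 1)
    have e2 : sq (-((m₀ + 1 : ℕ) : ℤ)) = -dnT (bdn m₀) := by
      rw [show -((m₀ + 1 : ℕ) : ℤ) = -((m₀ : ℤ) + 1) by push_cast; ring]; exact sq_neg m₀
    rw [e1, e2]
    rcases dnT_int (bdn (m₀ + 1)) with h1 | h1 <;> rcases dnT_int (bdn m₀) with h2 | h2
    · rw [h1, h2]
    · exfalso; apply hne; rw [h1, h2]; norm_num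
    · exfalso; apply hne; rw [h1, h2]; norm_num
    · rw [h1, h2]
  -- conclusion
  refine ⟨sq, hsq, fun M hM hnow0 hnow i j hij => ?_⟩
  rcases inv M hM with ⟨τ, -, hD⟩ | ⟨hneg, i', j', hij', hmem, harr⟩ | ⟨m₀, hm₀, hne, i', j', hij', hmem, harr⟩
  · rw [site]; exact (hD i j hij).1
  · exfalso
    refine hnow0 ⟨hneg, i', j', hij', ?_, ?_⟩
    · rw [site0]; exact hmem
    · rw [site0]; exact harr
  · exfalso
    refine hnow ⟨m₀ + 1, by omega, hm₀, typ m₀ hne, i', j', hij', ?_, ?_⟩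
    · rw [site]; exact hmem
    · rw [site]; exact harr

end Summit.Ventures.Crystal3D.Theorems.LocalStacking

end
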